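import Mathlib
import Summits.ValiantsHypothesis.ValiantsHypothesis.Theorems.NewtonUnitEquationsNewtonTauWeakKernelBootstrap

/-!
# `NewtonUnitEquationsNewtonTauWeakStubKernelBootstrapOfNF` — KERNEL BOOTSTRAP `V(N,c) ≤ (4N²+5)·V(4c²,c)`, registered form

Registered stub `stub_kernelBootstrapOfNF` of line `binomial-normal-form` (crux `NewtonTauWeak`,
stmt-ValiantsHypothesis-5904, lead c6, wave 3 = stub-critic plan Tier 1, rung S4).

Setting.  Items `j : Fin N` with weights `1 ≤ g j ≤ c` and exponents `d j ∈ ℕ²` (coincidences allowed); the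
weight-`v` level set of subset sums is `X_v = {Σ_{j ∈ J} d j : Σ_{j ∈ J} g j = v}`.  The density rank `rk c' j`
and the canonical sets `canon c' k α β` of a value vector `c'` are parameters characterised by `hrk`, `hcanon`.
Hypotheses: the PINNED exchange normal form `hNF` (every maximiser of `Σ_J c'` over `{Σ_J g = v}` has the weight
and the value of `canon c' k₀ α β` at the pinned prefix length `k₀ = Nat.findGreatest (prefix weight ≤ v) N`, with
`Σ_{a ≤ c} (α a + β a) ≤ 2c` and `α a = β a = 0` off `[1, c]`), and a bound `B` for the hull vertices of every
weighted level set on `n ≤ 4c·c` items with weights in `[1, c]` (`hB`).  Claim: `conv X_v` has at most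
`(4 (N * N) + 5) · B` extreme points.

Proof.  This is the landed kernel bootstrap `kernelBootstrapOfNF` (Theorems/…KernelBootstrap.lean: strict
exposure of a vertex, localisation of the canonical set to a kernel of `≤ 4c·c` items fixed inside each cell of the
arrangement of the `N²` density functionals, `ResidueDesignHullAux.signvec_plane_count`, reindexing of the kernel
level set to apply `hB`), whose normal-form hypothesis is the present `hNF` without the vanishing clause
`α a = β a = 0` off `[1, c]`; the clause is simply dropped.  Folklore; no named facts, no citations, no `def`s.
-/

-- Sub = Summit single-conjunct layout: the duplicated namespace component is mandated by the tree.
set_option linter.dupNamespace false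

noncomputable section

open scoped BigOperators

namespace Summit.ValiantsHypothesis.ValiantsHypothesis.Theorems.NewtonUnitEquationsNewtonTauWeak

/-- **Kernel bootstrap from the pinned normal form, registered stub `stub_kernelBootstrapOfNF` of line
`binomial-normal-form`** (`V(N, c) ≤ (4N² + 5) · V(4c², c)`).  For weights `1 ≤ g j ≤ c` and exponents
`d j ∈ ℕ²` (`j : Fin N`, coincidences allowed), granted the pinned exchange normal form `hNF` of the maximisers of
linear functions over `{J : Σ_J g j = v}` (canonical sets `canon c' k₀ α β`, `hrk`, `hcanon`, with
`Σ_{a ≤ c} (α a + β a) ≤ 2c` and `α`, `β` vanishing off `[1, c]`): if every weighted level set on `n ≤ 4c·c` items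
with weights in `[1, c]` has at most `B` hull vertices, then the convex hull of
`X_v = {Σ_{j ∈ J} d j : Σ_{j ∈ J} g j = v}` has at most `(4 (N * N) + 5) · B` extreme points.  Proof: the landed
`kernelBootstrapOfNF`, fed with `hNF` minus its vanishing clause. [folklore] -/
theorem stub_kernelBootstrapOfNF (N c v B : ℕ) (g : Fin N → ℕ) (hg : ∀ j, 1 ≤ g j ∧ g j ≤ c)
    (d : Fin N → (Fin 2 →₀ ℕ))
    (rk : (Fin N → ℝ) → Fin N → ℕ)
    (hrk : ∀ c' j, rk c' j = (Finset.univ.filter fun j' : Fin N =>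
        c' j * (g j' : ℝ) < c' j' * (g j : ℝ) ∨ (c' j' * (g j : ℝ) = c' j * (g j' : ℝ) ∧ j' < j)).card)
    (canon : (Fin N → ℝ) → ℕ → (ℕ → ℕ) → (ℕ → ℕ) → Finset (Fin N))
    (hcanon : ∀ c' k α β, canon c' k α β = Finset.univ.filter fun j : Fin N =>
        (rk c' j < k ∧ α (g j) ≤ (Finset.univ.filter fun j' : Fin N =>
            rk c' j' < k ∧ g j' = g j ∧
              (c' j' * (g j : ℝ) < c' j * (g j' : ℝ) ∨ (c' j * (g j' : ℝ) = c' j' * (g j : ℝ) ∧ j < j'))).card) ∨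
        (k ≤ rk c' j ∧ (Finset.univ.filter fun j' : Fin N =>
            k ≤ rk c' j' ∧ g j' = g j ∧
              (c' j * (g j' : ℝ) < c' j' * (g j : ℝ) ∨ (c' j' * (g j : ℝ) = c' j * (g j' : ℝ) ∧ j' < j))).card
            < β (g j)))
    (hNF : ∀ (c' : Fin N → ℝ) (J : Finset (Fin N)), ∑ j ∈ J, g j = v →
        (∀ J' : Finset (Fin N), ∑ j ∈ J', g j = v → ∑ j ∈ J', c' j ≤ ∑ j ∈ J, c' j) →
        ∃ (α β : ℕ → ℕ), (∑ a ∈ Finset.range (c + 1), (α a + β a) ≤ 2 * c) ∧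
          (∀ a, (a = 0 ∨ c < a) → α a = 0 ∧ β a = 0) ∧
          ∑ j ∈ canon c' (Nat.findGreatest
              (fun k => ∑ j ∈ (Finset.univ.filter fun j : Fin N => rk c' j < k), g j ≤ v) N) α β, g j = v ∧
          ∑ j ∈ canon c' (Nat.findGreatest
              (fun k => ∑ j ∈ (Finset.univ.filter fun j : Fin N => rk c' j < k), g j ≤ v) N) α β, c' j =
            ∑ j ∈ J, c' j)
    (hB : ∀ (n v' : ℕ) (g' : Fin n → ℕ) (d' : Fin n → (Fin 2 →₀ ℕ)), n ≤ 4 * c * c →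
      (∀ j, 1 ≤ g' j ∧ g' j ≤ c) →
      (Set.extremePoints ℝ (convexHull ℝ ((fun e : Fin 2 →₀ ℕ => fun i : Fin 2 => ((e i : ℕ) : ℝ)) ''
        (((Finset.univ.filter fun J : Finset (Fin n) => ∑ j ∈ J, g' j = v').image
          fun J => ∑ j ∈ J, d' j : Finset (Fin 2 →₀ ℕ)) : Set (Fin 2 →₀ ℕ))))).ncard ≤ B) :
    (Set.extremePoints ℝ (convexHull ℝ ((fun e : Fin 2 →₀ ℕ => fun i : Fin 2 => ((e i : ℕ) : ℝ)) ''
      (((Finset.univ.filter fun J : Finset (Fin N) => ∑ j ∈ J, g j = v).image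
        fun J => ∑ j ∈ J, d j : Finset (Fin 2 →₀ ℕ)) : Set (Fin 2 →₀ ℕ))))).ncard ≤ (4 * (N * N) + 5) * B := by
  refine kernelBootstrapOfNF N c v B g hg d rk hrk canon hcanon (fun c' J hJ hmax => ?_) hB
  obtain ⟨α, β, hsum, -, hKv, hKval⟩ := hNF c' J hJ hmax
  exact ⟨α, β, hsum, hKv, hKval⟩

end Summit.ValiantsHypothesis.ValiantsHypothesis.Theorems.NewtonUnitEquationsNewtonTauWeak

end
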